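import Summits.Ventures.WeilGRH.DualTrigUniversalCells
import Summits.Ventures.WeilGRH.UniformConductorFloorCellsOneB
import Summits.Ventures.WeilGRH.DualTrigUniversalOddLog8Half
import HarnessLib

/-!
# Weil positivity at `t = 1` for EVERY ODD Dirichlet character of EVERY modulus `q ≥ 61` (archimedean certificate × cell certificate)

Cell `rh-explicit`, WEIL TRACK — GRH ARM (weil-grh-3 route B × weil-grh-1 uniform floors).  The JOINT floor of
`DualTrigUniversalCells.lean` for ODD characters: the archimedean-only kernel certificate `ucert_odd_8` (`q_c = 7`,
`DualTrigUniversalOddLog8Half.lean`) and the `t = 1`, `J = 40` cell certificate `one40` of weil-grh-1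
(`UniformConductorFloorCellsOneB.lean`, `ρ = 10753/5000 = 2.1506`) give `WeilPositivityOnChar χ 1` for every odd
character of modulus `q ≥ 61` (`log 7 + 2.1506 = 4.0965 ≤ log 61`) — vs `80` (cells × Lorentzian archimedean budget,
`UniformFloor.weilPositivityOnChar_one_of_odd_ge_80`) and `216` (archimedean certificate × sliver budget); the data floor is
`30`.  The even half (`q ≥ 155`) waits for the even certificate file.  No named facts, no `sorry`; no kernel evaluation here.
-/

namespace Summit.Ventures.WeilGRH

open Literature.NumberTheory.LFunctions UniformFloor

/-- `log 7 + 2.1506 ≤ log 61` (`61 = 60 · 61/60`). [folklore] -/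
theorem log_61_ge : Real.log ((7 : ℕ) : ℝ) + 10753 / 5000 ≤ Real.log ((61 : ℕ) : ℝ) := by
  have h2 := Real.log_two_gt_d9; have h3 := Real.log_three_gt_d9; have h5 := Real.log_five_gt_d9
  have h7 := log_seven_le
  have e7 : Real.log ((7 : ℕ) : ℝ) = Real.log 7 := by norm_num
  have e61 : Real.log ((61 : ℕ) : ℝ) = 2 * Real.log 2 + Real.log 3 + Real.log 5 + Real.log (61 / 60) := by
    rw [show ((61 : ℕ) : ℝ) = 2 ^ 2 * 3 * 5 * (61 / 60) by norm_num, Real.log_mul (by norm_num) (by norm_num),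
      Real.log_mul (by norm_num) (by norm_num), Real.log_mul (by norm_num) (by norm_num), Real.log_pow]
    push_cast; ring
  have h61 : 1 - (61 / 60 : ℝ)⁻¹ ≤ Real.log (61 / 60) := Real.one_sub_inv_le_log_of_pos (by norm_num)
  rw [e7, e61]
  norm_num at h61 ⊢
  linarith

/-- **`t = 1` for every ODD Dirichlet character of every modulus `q ≥ 61`** (`ucert_odd_8` × `one40`). [folklore] -/
theorem weilPositivityOnChar_one_of_odd_ge_61 {q : ℕ} (hq : 61 ≤ q) (χ : DirichletCharacter ℂ q)
    (hpar : charParity χ = 1) : WeilPositivityOnChar χ 1 := by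
  have hq1 : q ≠ 1 := by omega
  have hlog : Real.log (ucert_odd_8.q : ℝ) + 10753 / 5000 ≤ Real.log (q : ℝ) := by
    have hmono := Real.log_le_log (by norm_num) (by exact_mod_cast hq : ((61 : ℕ) : ℝ) ≤ (q : ℝ))
    rw [show (ucert_odd_8.q : ℝ) = ((7 : ℕ) : ℝ) by norm_num [ucert_odd_8]]
    exact log_61_ge.trans hmono
  exact DKCert.weilPositivityOnChar_universal_of_check_of_cells ucert_odd_8_check rfl rfl one_pos exp_two_le_eight
    (by decide) hq1 χ hpar (by norm_num) phiOne40 (by norm_num : (0 : ℝ) < 3389 / 10000) one40_philo one40_phihi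
    one40_phiout sOne40 one40_shifts wbar7 (wbar7_ge 7 le_rfl) one40_cert hlog

end Summit.Ventures.WeilGRH
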